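import Summits.AnomalousDissipation.AnomalousDissipation.Theorems.KolmogorovFloor.Negative.AxisBeat

/-!
# The axis-carrier beat with a separation offset (negative side of `KolmogorovFloor`, stmt-14030)

cdisprove seat `refuter-cdisprove-stmt-AnomalousDissipation-14030-0` (2026-08-16). Variant of
`Negative/AxisBeat.lean :: axis_beat_data` with carriers `p = m eᵢ − q`, `p + q = m eᵢ`, `m = 3N + 1 + 2K₀`:
besides lying outside the ball (`N < |p|, |p+q| ≤ 4N + 1 + 2K₀`) the carriers stay `> N` away from EVERY
frequency `k` with `|kⱼ| ≤ K₀` (`|p ± k|, |p + q ± k| > N`), so that the waves do not interact, against a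
band-limited multiplier, with a resolved BASE MODE at such a `k` — the laminar ray of the energy-channel
analysis (`Negative/WeightsVanish.lean`). Gain `≥ (9/10) α² ‖ĝ‖` as before.
-/

noncomputable section

open MeasureTheory UnitAddTorus Matrix
open scoped InnerProductSpace ENNReal ComplexConjugate

namespace Summit.AnomalousDissipation.AnomalousDissipation.Theorems.KolmogorovFloor.Negative

open Literature.Analysis.FunctionSpaces Literature.Analysis.FluidPDE
open Summit.AnomalousDissipation.AnomalousDissipation.Theorems.TaylorCertificatePair.Negative

/-- `|m eᵢ − q + k|² ≥ (m − qᵢ + kᵢ)²`-type coordinate bound: the `i`-th coordinate of `m eᵢ − q + k`. -/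
theorem freqNormSq_single_sub_add_ge (i : Fin 3) (m : ℤ) (q k : Fin 3 → ℤ) :
    ((m : ℝ) - (q i) + (k i)) ^ 2 ≤ Torus.freqNormSq (Pi.single i m - q + k) := by
  have h := sq_apply_le_freqNormSq (Pi.single i m - q + k) i
  have e : (((Pi.single i m - q + k : Fin 3 → ℤ) i : ℤ) : ℝ) = (m : ℝ) - (q i) + (k i) := by
    simp
  rw [e] at h
  exact h

/-- Same for `m eᵢ + k`. -/
theorem freqNormSq_single_add_ge (i : Fin 3) (m : ℤ) (k : Fin 3 → ℤ) :
    ((m : ℝ) + (k i)) ^ 2 ≤ Torus.freqNormSq (Pi.single i m + k) := by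
  have h := sq_apply_le_freqNormSq (Pi.single i m + k) i
  have e : (((Pi.single i m + k : Fin 3 → ℤ) i : ℤ) : ℝ) = (m : ℝ) + (k i) := by
    simp
  rw [e] at h
  exact h

/-- **Axis carriers with offset.** For `|q| ≤ N`, any axis `i` and `m = 3N + 1 + 2K₀`: `p = m eᵢ − q`,
`p + q = m eᵢ` (and `p + (p+q)`) lie outside the ball, `|p|, |p+q| ≤ 4N + 1 + 2K₀`, and `p ± k`, `p + q ± k`
lie outside the ball for every `k` with all `|kⱼ| ≤ K₀`. -/
theorem axis_carriers_offset (N K₀ : ℕ) {q : Fin 3 → ℤ} (hqN : Torus.freqNormSq q ≤ (N : ℝ) ^ 2) (i : Fin 3) :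
    (N : ℝ) ^ 2 < Torus.freqNormSq (Pi.single i ((3 * N + 1 + 2 * K₀ : ℕ) : ℤ) - q) ∧
    (N : ℝ) ^ 2 < Torus.freqNormSq (Pi.single i ((3 * N + 1 + 2 * K₀ : ℕ) : ℤ) - q + q) ∧
    (N : ℝ) ^ 2 < Torus.freqNormSq (Pi.single i ((3 * N + 1 + 2 * K₀ : ℕ) : ℤ) - q + (Pi.single i ((3 * N + 1 + 2 * K₀ : ℕ) : ℤ) - q + q)) ∧
    Torus.freqNormSq (Pi.single i ((3 * N + 1 + 2 * K₀ : ℕ) : ℤ) - q) ≤ ((4 * N + 1 + 2 * K₀ : ℕ) : ℝ) ^ 2 ∧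
    Torus.freqNormSq (Pi.single i ((3 * N + 1 + 2 * K₀ : ℕ) : ℤ) - q + q) ≤ ((4 * N + 1 + 2 * K₀ : ℕ) : ℝ) ^ 2 ∧
    (∀ k : Fin 3 → ℤ, (∀ j, ((k j : ℝ)) ^ 2 ≤ (K₀ : ℝ) ^ 2) →
      (N : ℝ) ^ 2 < Torus.freqNormSq (Pi.single i ((3 * N + 1 + 2 * K₀ : ℕ) : ℤ) - q + k) ∧
      (N : ℝ) ^ 2 < Torus.freqNormSq (Pi.single i ((3 * N + 1 + 2 * K₀ : ℕ) : ℤ) - q - k) ∧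
      (N : ℝ) ^ 2 < Torus.freqNormSq (Pi.single i ((3 * N + 1 + 2 * K₀ : ℕ) : ℤ) - q + q + k) ∧
      (N : ℝ) ^ 2 < Torus.freqNormSq (Pi.single i ((3 * N + 1 + 2 * K₀ : ℕ) : ℤ) - q + q - k)) := by
  have hq0 : 0 ≤ Torus.freqNormSq q := Torus.freqNormSq_nonneg q
  have hN0 : (0 : ℝ) ≤ N := Nat.cast_nonneg N
  have hK0 : (0 : ℝ) ≤ K₀ := Nat.cast_nonneg K₀
  have hqi : ((q i : ℝ)) ^ 2 ≤ (N : ℝ) ^ 2 := (sq_apply_le_freqNormSq q i).trans hqN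
  have hb := abs_le_of_sq_le_sq' hqi hN0
  have hqiN : (q i : ℝ) ≤ N := hb.2
  have hqiN' : -(N : ℝ) ≤ (q i : ℝ) := hb.1
  have em : (((3 * N + 1 + 2 * K₀ : ℕ) : ℤ) : ℝ) = 3 * N + 1 + 2 * K₀ := by push_cast; ring
  have e4 : (((4 * N + 1 + 2 * K₀ : ℕ)) : ℝ) = 4 * N + 1 + 2 * K₀ := by push_cast; ring
  refine ⟨?_, ?_, ?_, ?_, ?_, ?_⟩
  · rw [freqNormSq_single_sub, em]; nlinarith
  · rw [sub_add_cancel, freqNormSq_single, em]; nlinarith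
  · rw [sub_add_cancel, freqNormSq_single_sub_add_single, em]; nlinarith
  · rw [freqNormSq_single_sub, em, e4]; nlinarith
  · rw [sub_add_cancel, freqNormSq_single, em, e4]; nlinarith
  · intro k hk
    have hki : ((k i : ℝ)) ^ 2 ≤ (K₀ : ℝ) ^ 2 := hk i
    have hkb := abs_le_of_sq_le_sq' hki hK0
    refine ⟨?_, ?_, ?_, ?_⟩
    · refine lt_of_lt_of_le ?_ (freqNormSq_single_sub_add_ge i _ q k)
      rw [em]; nlinarith [hkb.1, hkb.2]
    · have h := freqNormSq_single_sub_add_ge i (((3 * N + 1 + 2 * K₀ : ℕ) : ℤ)) q (-k)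
      rw [← sub_eq_add_neg] at h
      refine lt_of_lt_of_le ?_ h
      rw [em]; simp only [Pi.neg_apply, Int.cast_neg]; nlinarith [hkb.1, hkb.2]
    · rw [sub_add_cancel]
      refine lt_of_lt_of_le ?_ (freqNormSq_single_add_ge i _ k)
      rw [em]; nlinarith [hkb.1, hkb.2]
    · rw [sub_add_cancel]
      have h := freqNormSq_single_add_ge i (((3 * N + 1 + 2 * K₀ : ℕ) : ℤ)) (-k)
      rw [← sub_eq_add_neg] at h
      refine lt_of_lt_of_le ?_ h
      rw [em]; simp only [Pi.neg_apply, Int.cast_neg]; nlinarith [hkb.1, hkb.2]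

/-- **Axis beat data with offset.** As `axis_beat_data`, with carriers `m = 3N + 1 + 2K₀` that in addition
stay outside the ball after translation by any frequency `k` with all `|kⱼ| ≤ K₀` (both signs). -/
theorem axis_beat_data_offset {q : Fin 3 → ℤ} (hq0 : q ≠ 0) {N : ℕ} (K₀ : ℕ) (hqN : Torus.freqNormSq q ≤ (N : ℝ) ^ 2)
    (g : (EuclideanSpace ℂ (Fin 3))) (hg0 : g ≠ 0) (hgq : ((fun j => ((q) j : ℂ)) ⬝ᵥ (WithLp.ofLp (g))) = 0)
    {α : ℝ} (hα : 0 ≤ α) :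
    ∃ (p : Fin 3 → ℤ) (zA zB : (EuclideanSpace ℂ (Fin 3))) (gain : ℝ),
      (N : ℝ) ^ 2 < Torus.freqNormSq p ∧ (N : ℝ) ^ 2 < Torus.freqNormSq (p + q) ∧
      (N : ℝ) ^ 2 < Torus.freqNormSq (p + (p + q)) ∧
      Torus.freqNormSq p ≤ ((4 * N + 1 + 2 * K₀ : ℕ) : ℝ) ^ 2 ∧ Torus.freqNormSq (p + q) ≤ ((4 * N + 1 + 2 * K₀ : ℕ) : ℝ) ^ 2 ∧
      (∀ k : Fin 3 → ℤ, (∀ j, ((k j : ℝ)) ^ 2 ≤ (K₀ : ℝ) ^ 2) →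
        (N : ℝ) ^ 2 < Torus.freqNormSq (p + k) ∧ (N : ℝ) ^ 2 < Torus.freqNormSq (p - k) ∧
        (N : ℝ) ^ 2 < Torus.freqNormSq (p + q + k) ∧ (N : ℝ) ^ 2 < Torus.freqNormSq (p + q - k)) ∧
      ((fun j => ((p) j : ℂ)) ⬝ᵥ (WithLp.ofLp (zA))) = 0 ∧ ((fun j => (((p + q)) j : ℂ)) ⬝ᵥ (WithLp.ofLp (zB))) = 0 ∧
      ((fun j => ((q) j : ℂ)) ⬝ᵥ (WithLp.ofLp (zB))) = 0 ∧ ‖zA‖ ≤ α ∧ ‖zB‖ ≤ α ∧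
      Real.pi * (conj (((fun j => ((q) j : ℂ)) ⬝ᵥ (WithLp.ofLp (zA)))) * ⟪g, zB⟫_ℂ).im ≤ -gain ∧
      9 / 10 * α ^ 2 * ‖g‖ ≤ gain := by
  -- axis and its cross vector
  obtain ⟨i, hc0, hT⟩ := axis_selection g hg0 hgq hq0
  set c : Fin 3 → ℤ := (![![0, -(q 2), q 1], ![q 2, 0, -(q 0)], ![-(q 1), q 0, 0]] : Fin 3 → (Fin 3 → ℤ)) i with hcdef
  have hcq : c ⬝ᵥ q = 0 := axisCross_dot q i
  set a : Fin 3 → ℝ := fun j => ((c j : ℝ)) with hadef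
  have hcc1 : 1 ≤ Torus.freqNormSq c := Torus.one_le_freqNormSq_of_ne_zero hc0
  have haa : a ⬝ᵥ a = Torus.freqNormSq c := by rw [freqNormSq_eq_castR_dot]
  have ha2 : 0 < a ⬝ᵥ a := by rw [haa]; linarith
  obtain ⟨hB1, hBw⟩ := unit_along a ha2
  set B : (EuclideanSpace ℝ (Fin 3)) := (Real.sqrt (a ⬝ᵥ a))⁻¹ • (WithLp.toLp 2 a : (EuclideanSpace ℝ (Fin 3))) with hBdef
  have hs0 : 0 < Real.sqrt (a ⬝ᵥ a) := Real.sqrt_pos.2 ha2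
  -- the captured coefficient `ζ = ⟪ĝ, B⟫`
  set ζ : ℂ := ⟪g, EuclideanSpace.complexify B⟫_ℂ with hζdef
  have hζ : ζ = (((Real.sqrt (a ⬝ᵥ a))⁻¹ : ℝ) : ℂ) * ⟪g, EuclideanSpace.complexify (WithLp.toLp 2 a)⟫_ℂ := by
    rw [hζdef, hBdef, LinearIsometry.map_smul, ← Complex.coe_smul, inner_smul_right]
  have hζn : ‖ζ‖ ^ 2 * Torus.freqNormSq c = ‖⟪g, EuclideanSpace.complexify (WithLp.toLp 2 a)⟫_ℂ‖ ^ 2 := by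
    rw [hζ, norm_mul, Complex.norm_real, Real.norm_of_nonneg (inv_nonneg.2 hs0.le), mul_pow, inv_pow,
      Real.sq_sqrt ha2.le, haa]
    have : Torus.freqNormSq c ≠ 0 := by linarith
    field_simp
  have hζ0 : ζ ≠ 0 := by
    intro h
    rw [h, norm_zero] at hζn
    have hq1 : 1 ≤ Torus.freqNormSq q := Torus.one_le_freqNormSq_of_ne_zero hq0
    have hgp : 0 < ‖g‖ ^ 2 := by positivity
    have : ‖⟪g, EuclideanSpace.complexify (WithLp.toLp 2 a)⟫_ℂ‖ ^ 2 = 0 := by rw [← hζn]; ring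
    rw [hadef] at this
    rw [this] at hT
    nlinarith
  -- carriers
  set m : ℤ := ((3 * N + 1 + 2 * K₀ : ℕ) : ℤ) with hmdef
  obtain ⟨hNp, hNpq, hN5, hLp, hLpq, hsep⟩ := axis_carriers_offset N K₀ hqN i
  set p : Fin 3 → ℤ := Pi.single i m - q with hpdef
  have hpq : p + q = Pi.single i m := by rw [hpdef, sub_add_cancel]
  -- polarisation `z_B`
  set zB : (EuclideanSpace ℂ (Fin 3)) := (((-Complex.I * conj ((ζ)) * ((‖(ζ)‖⁻¹ : ℝ) : ℂ)) * ((α) : ℂ)) • EuclideanSpace.complexify (B)) with hzBdef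
  have hzBn : ‖zB‖ = α := norm_polB α hα hζ0 hB1
  have hdB : ((fun j => (((p + q)) j : ℂ)) ⬝ᵥ (WithLp.ofLp (zB))) = 0 := by
    rw [hzBdef, dotc_polB, hpq, hBw, single_dot_axisCross]
    simp
  have hBq : ((fun j => ((q) j : ℂ)) ⬝ᵥ (WithLp.ofLp (zB))) = 0 := by
    rw [hzBdef, dotc_polB, hBw]
    have : (fun j => ((q) j : ℝ)) ⬝ᵥ a = 0 := by
      rw [hadef, castR_dot, dotProduct_comm, hcq]; simp
    rw [this]; simp
  -- polarisation `z_A`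
  set v : Fin 3 → ℤ := (p ⬝ᵥ p) • q - (q ⬝ᵥ p) • p with hvdef
  set D : ℤ := (p ⬝ᵥ p) * (q ⬝ᵥ q) - (q ⬝ᵥ p) ^ 2 with hDdef
  have hDv : q ⬝ᵥ v = D := by rw [hvdef, hDdef]; exact q_dot_pol p q
  have hpv : p ⬝ᵥ v = 0 := by rw [hvdef, dotProduct_comm]; exact pol_dot_p p q
  have hvv : v ⬝ᵥ v = (p ⬝ᵥ p) * D := by rw [hvdef, hDdef]; exact pol_dot_pol p q
  have hDm : D = m ^ 2 * (c ⬝ᵥ c) := by rw [hDdef, hpdef, hcdef]; exact lagrange_axis i m q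
  have hcc : ((c ⬝ᵥ c : ℤ) : ℝ) = Torus.freqNormSq c := by rw [freqNormSq_eq_castR_dot, castR_dot]
  have hpp : ((p ⬝ᵥ p : ℤ) : ℝ) = Torus.freqNormSq p := by rw [freqNormSq_eq_castR_dot, castR_dot]
  have hp1 : 1 ≤ Torus.freqNormSq p := by
    have hp0 : p ≠ 0 := ne_zero_of_freqNormSq_pos (sq_nonneg _) hNp
    exact Torus.one_le_freqNormSq_of_ne_zero hp0
  have hmR : (m : ℝ) = 3 * N + 1 + 2 * K₀ := by rw [hmdef]; push_cast; ring
  have hm1 : (1 : ℝ) ≤ (m : ℝ) := by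
    rw [hmR]; linarith [(Nat.cast_nonneg N : (0:ℝ) ≤ N), (Nat.cast_nonneg K₀ : (0:ℝ) ≤ K₀)]
  have hDpos : 0 < (D : ℝ) := by
    rw [hDm]; push_cast; rw [hcc]
    have : (1 : ℝ) ≤ (m : ℝ) ^ 2 := one_le_pow₀ hm1
    nlinarith
  set vL : (EuclideanSpace ℝ (Fin 3)) := WithLp.toLp 2 (fun j => ((v j : ℝ))) with hvLdef
  have hvL2 : ‖vL‖ ^ 2 = Torus.freqNormSq p * D := by
    rw [hvLdef, norm_sq_toLp, castR_dot, hvv]; push_cast; rw [hpp]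
  have hvLpos : 0 < ‖vL‖ := by
    have h2 : 0 < ‖vL‖ ^ 2 := by rw [hvL2]; positivity
    rcases (norm_nonneg vL).lt_or_eq with h | h
    · exact h
    · rw [← h] at h2; simp at h2
  set zA : (EuclideanSpace ℂ (Fin 3)) := (((α / ‖vL‖ : ℝ)) : ℂ) • EuclideanSpace.complexify vL with hzAdef
  have hzAn : ‖zA‖ = α := by
    rw [hzAdef, norm_smul, Complex.norm_real, Real.norm_of_nonneg (div_nonneg hα hvLpos.le),
      EuclideanSpace.norm_complexify, div_mul_cancel₀ _ hvLpos.ne']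
  have hdotA : ∀ κ : Fin 3 → ℤ, ((fun j => ((κ) j : ℂ)) ⬝ᵥ (WithLp.ofLp (zA))) =
      (((α / ‖vL‖ : ℝ)) : ℂ) * ((κ ⬝ᵥ v : ℤ) : ℂ) := by
    intro κ
    rw [hzAdef, dotc_smul, hvLdef, dotc_complexify_castR]
  have hdA : ((fun j => ((p) j : ℂ)) ⬝ᵥ (WithLp.ofLp (zA))) = 0 := by
    rw [hdotA, hpv]; simp
  have hqzA : ((fun j => ((q) j : ℂ)) ⬝ᵥ (WithLp.ofLp (zA))) = (((α / ‖vL‖ * D : ℝ)) : ℂ) := by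
    rw [hdotA, hDv]; push_cast; ring
  -- the value of the beat
  set gain : ℝ := Real.pi * (α / ‖vL‖ * D) * α * ‖ζ‖ with hgaindef
  have hinner : ⟪g, zB⟫_ℂ = (α : ℂ) * (-Complex.I * (‖ζ‖ : ℂ)) := by
    rw [hzBdef, inner_polB, ← hζdef]
    rw [show (-Complex.I * conj ζ * ((‖ζ‖⁻¹ : ℝ) : ℂ)) * (α : ℂ) * ζ =
        (α : ℂ) * ((-Complex.I * conj ζ * ((‖ζ‖⁻¹ : ℝ) : ℂ)) * ζ) by ring, phase_mul_self ζ hζ0]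
  have hbeat : Real.pi * (conj (((fun j => ((q) j : ℂ)) ⬝ᵥ (WithLp.ofLp (zA)))) * ⟪g, zB⟫_ℂ).im ≤ -gain := by
    rw [hqzA, hinner, Complex.conj_ofReal]
    have e : ((((α / ‖vL‖ * D : ℝ)) : ℂ) * ((α : ℂ) * (-Complex.I * (‖ζ‖ : ℂ)))).im =
        -(α / ‖vL‖ * D * α * ‖ζ‖) := by
      simp [Complex.mul_im, Complex.mul_re]
      ring
    rw [e, hgaindef]
    linarith
  -- the gain
  have hgain : 9 / 10 * α ^ 2 * ‖g‖ ≤ gain := by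
    have hT' : Torus.freqNormSq q * ‖g‖ ^ 2 ≤ 3 * ‖⟪g, EuclideanSpace.complexify (WithLp.toLp 2 a)⟫_ℂ‖ ^ 2 := hT
    have hDR : (D : ℝ) = (m : ℝ) ^ 2 * Torus.freqNormSq c := by rw [hDm]; push_cast; rw [hcc]
    have hpp4 : Torus.freqNormSq p ≤ 4 * (m : ℝ) ^ 2 := by
      have e4 : (((4 * N + 1 + 2 * K₀ : ℕ)) : ℝ) = 4 * N + 1 + 2 * K₀ := by push_cast; ring
      rw [e4] at hLp
      rw [hmR]
      nlinarith [(Nat.cast_nonneg N : (0:ℝ) ≤ N), (Nat.cast_nonneg K₀ : (0:ℝ) ≤ K₀)]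
    have hpp0 : 0 < Torus.freqNormSq p := by linarith
    have hm0 : 0 < (m : ℝ) := by linarith
    rw [hgaindef]
    have e : Real.pi * (α / ‖vL‖ * ↑D) * α * ‖ζ‖ = Real.pi * (α * ↑D / ‖vL‖) * α * ‖ζ‖ := by ring
    rw [e]
    exact axis_gain_bound (r := α * D / ‖vL‖) rfl hvL2 hvLpos hDR hcc1 hpp4 hpp0 hζn hT'
      (Torus.one_le_freqNormSq_of_ne_zero hq0) hα (norm_nonneg g) (norm_nonneg ζ) hm0
  exact ⟨p, zA, zB, gain, hNp, hNpq, hN5, hLp, hLpq, hsep, hdA, hdB, hBq, hzAn.le, hzBn.le, hbeat, hgain⟩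

end Summit.AnomalousDissipation.AnomalousDissipation.Theorems.KolmogorovFloor.Negative
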